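import Summits.MatrixMultiplication.OmegaCensus.DicyclicLaw32Z4Z4
import Summits.MatrixMultiplication.OmegaCensus.DicyclicLawRankThreeQuotientAll
import HarnessLib

/-!
# The order-`64` dicyclic-type groups: the dicyclic law `80` is not attained unless `A/⟨c₀⟩ ∈ {ℤ₁₆, ℤ₂ × ℤ₈}`

ω-census `pub-omega`, family (b3), seat pub-omega-group gen 15.  Framing: lottery ticket; floor = certified bounds/negative
ranges.  VALUE: kernel theorems about the group-theoretic method (TPP capacity of dihedral-like groups); NOT progress on ω.

A dicyclic-type group `G(A, c₀)` (`ρ, τ : A → G` with the dihedral-like relations, `τa·τb = ρ(c₀ + b − a)`, `c₀ ≠ 0`) with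
`|A| = 32` has order `64`, and its TPP triples satisfy `3|S||T||U| + 16 ≤ 8|A| = 256` (`tpp_volume_le_law_dicyclicLike`),
i.e. `|S||T||U| ≤ 80`, with equality (the dicyclic law) attained when `A/⟨c₀⟩` has a cyclic subgroup of index `≤ 2`
(`dicyclic_law_iff_of_quot`, gen 11).  The abelian groups of order `16` WITHOUT a cyclic subgroup of index `≤ 2` are
`ℤ₂⁴`, `ℤ₂² × ℤ₄` (both map onto `𝔽₂³`) and `ℤ₄²`.

**Theorem (`no_dicyclic_law_card_32`).** Dicyclic type, `|A| = 32`, and either three homomorphisms `A →+ ZMod 2` killing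
`c₀` jointly onto `𝔽₂³`, or `Φ : A ↠ ZMod 4 × ZMod 4` with `Φ c₀ = 0`.  Then NO TPP triple attains `3|S||T||U| + 16 = 8|A|`.
(`𝔽₂³` branch: `no_dicyclic_law_of_onto_f2cube`, valid for every `|A|`; `ℤ₄²` branch: `no_dicyclic_law_card_32_of_onto_z4z4`.)

**Instances — the seven order-`64` dicyclic-type groups `G(A, c₀)` whose quotient has no cyclic subgroup of index `≤ 2`**
(census rows NR115–NR120, engine-certified `β = 64` ×2; the kernel statement here is `β < 80`, i.e. the LAW is not
attained, which is the classification line):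
* `z2_z2_z8_dicyclic_no_law` — `G(ℤ₂²×ℤ₈,(0,0,4)) = C₂² × Q₁₆` (NR115), quotient `ℤ₂² × ℤ₄`;
* `z2_z2_z2_z4_dicyclic_no_law_0_0_0_2` — `G(ℤ₂³×ℤ₄,(0,0,0,2)) = C₂³ × Q₈` (NR116), quotient `ℤ₂⁴`;
* `z4_z8_dicyclic_no_law_0_4` — `G(ℤ₄×ℤ₈,(0,4))` (NR117), quotient `ℤ₄²` (in `DicyclicLaw32Z4Z4.lean`);
* `z2_z4_z4_dicyclic_no_law_1_0_0` — `G(ℤ₂×ℤ₄²,(1,0,0))` (NR118), quotient `ℤ₄²` (in `DicyclicLaw32Z4Z4.lean`);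
* `z2_z4_z4_dicyclic_no_law_0_2_0` — `G(ℤ₂×ℤ₄²,(0,2,0)) = C₂ × (ℤ₄ ⋊ Q₈)` (NR119), quotient `ℤ₂² × ℤ₄`;
* `z2_z2_z2_z4_dicyclic_no_law_1_0_0_0` — `G(ℤ₂³×ℤ₄,(1,0,0,0)) = C₂² × (ℤ₄ ⋊ ℤ₄)` (NR120), quotient `ℤ₂² × ℤ₄`;
* `z2_pow_five_dicyclic_no_law` — `G(ℤ₂⁵, e₁) ≅ ℤ₄ × ℤ₂³` (abelian), quotient `ℤ₂⁴`.
Together with the five attained cases (`A/⟨c₀⟩ ∈ {ℤ₁₆, ℤ₂ × ℤ₈}`, kernel laws via `dicyclic_law_of_quot_cyclic` /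
`z4_z2m_dicyclic_law`) this is the complete order-`64` line of the dicyclic-type classification:
**law attained ⟺ `A/⟨c₀⟩` has a cyclic subgroup of index `≤ 2`.**
-/

namespace Summit.MatrixMultiplication.OmegaCensus

open Literature.Combinatorics.Additive Finset

section Card32

variable {A : Type} [AddCommGroup A] [DecidableEq A] [Fintype A] {G : Type} [Group G] [DecidableEq G]
  {ρ τ : A → G} {c₀ : A}

/-- **The dicyclic law at `|A| = 32` is not attained when `A/⟨c₀⟩ ↠ 𝔽₂³` or `A/⟨c₀⟩ ↠ ℤ₄²`** (i.e. when `A/⟨c₀⟩`, of order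
`16`, has no cyclic subgroup of index `≤ 2`).  For every TPP triple: `3|S||T||U| + 16 ≠ 8|A|`. [folklore] -/
theorem no_dicyclic_law_card_32
    (hρρ : ∀ a b, ρ a * ρ b = ρ (a + b)) (hρτ : ∀ a b, ρ a * τ b = τ (b - a))
    (hτρ : ∀ a b, τ a * ρ b = τ (a + b)) (hττ : ∀ a b, τ a * τ b = ρ (c₀ + b - a)) (hc₀ : c₀ ≠ 0)
    (hρ : Function.Injective ρ) (hτ : Function.Injective τ) (hne : ∀ a b, ρ a ≠ τ b)
    (hsurj : ∀ g, (∃ a, ρ a = g) ∨ (∃ a, τ a = g)) (hA : Fintype.card A = 32)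
    (hquot : (∃ ψ₁ ψ₂ ψ₃ : A →+ ZMod 2, (ψ₁ c₀ = 0 ∧ ψ₂ c₀ = 0 ∧ ψ₃ c₀ = 0) ∧
        ∀ v : ZMod 2 × ZMod 2 × ZMod 2, ∃ x, (ψ₁ x, ψ₂ x, ψ₃ x) = v) ∨
      (∃ Φ : A →+ ZMod 4 × ZMod 4, Function.Surjective Φ ∧ Φ c₀ = 0))
    {S T U : Finset G} (h : TripleProductProperty S T U) :
    3 * (S.card * T.card * U.card) + 16 ≠ 8 * Fintype.card A := by
  rcases hquot with ⟨ψ₁, ψ₂, ψ₃, hψc, hψ⟩ | ⟨Φ, hΦ, hΦc⟩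
  · exact no_dicyclic_law_of_onto_f2cube hρρ hρτ hτρ hττ hc₀ hρ hτ hne hsurj ψ₁ ψ₂ ψ₃ hψc hψ h
  · exact no_dicyclic_law_card_32_of_onto_z4z4 hρρ hρτ hτρ hττ hc₀ hρ hτ hne hsurj hA Φ hΦ hΦc h

end Card32

/-! ## Instances: the order-`64` dicyclic-type groups with `A/⟨c₀⟩ ↠ 𝔽₂³` -/

section Instances

/-- **`G(ℤ₂ × ℤ₂ × ℤ₈, (0,0,4)) = C₂² × Q₁₆`** (census row NR115; quotient `ℤ₂² × ℤ₄`): the dicyclic law `3V + 16 = 8·32`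
(`V = 80`) is not attained. [folklore] -/
theorem z2_z2_z8_dicyclic_no_law [Fact (((0, 0, 4) : ZMod 2 × ZMod 2 × ZMod 8) + (0, 0, 4) = 0)]
    (S T U : Finset (DihedralLikeGroup (ZMod 2 × ZMod 2 × ZMod 8) (0, 0, 4)))
    (h : TripleProductProperty S T U) :
    3 * (S.card * T.card * U.card) + 16 ≠ 8 * Fintype.card (ZMod 2 × ZMod 2 × ZMod 8) := by
  refine no_dicyclic_law_of_onto_f2cube (A := ZMod 2 × ZMod 2 × ZMod 8) (c₀ := (0, 0, 4))
    DihedralLikeGroup.rho_mul_rho DihedralLikeGroup.rho_mul_tau DihedralLikeGroup.tau_mul_rho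
    DihedralLikeGroup.tau_mul_tau (by decide) DihedralLikeGroup.rho_injective DihedralLikeGroup.tau_injective
    DihedralLikeGroup.rho_ne_tau DihedralLikeGroup.rho_or_tau
    (AddMonoidHom.fst _ _) ((AddMonoidHom.fst _ _).comp (AddMonoidHom.snd _ _))
    ((ZMod.castHom (show 2 ∣ 8 by norm_num) (ZMod 2)).toAddMonoidHom.comp
      ((AddMonoidHom.snd _ _).comp (AddMonoidHom.snd _ _)))
    (by decide) ?_ h
  rintro ⟨v₁, v₂, v₃⟩
  obtain ⟨b, hb⟩ := ZMod.castHom_surjective (show 2 ∣ 8 by norm_num) (n := 8) v₃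
  exact ⟨(v₁, v₂, b), Prod.ext rfl (Prod.ext rfl hb)⟩

/-- **`G(ℤ₂ × ℤ₂ × ℤ₂ × ℤ₄, (0,0,0,2)) = C₂³ × Q₈`** (census row NR116; quotient `ℤ₂⁴`): the dicyclic law is not attained.
[folklore] -/
theorem z2_z2_z2_z4_dicyclic_no_law_0_0_0_2
    [Fact (((0, 0, 0, 2) : ZMod 2 × ZMod 2 × ZMod 2 × ZMod 4) + (0, 0, 0, 2) = 0)]
    (S T U : Finset (DihedralLikeGroup (ZMod 2 × ZMod 2 × ZMod 2 × ZMod 4) (0, 0, 0, 2)))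
    (h : TripleProductProperty S T U) :
    3 * (S.card * T.card * U.card) + 16 ≠ 8 * Fintype.card (ZMod 2 × ZMod 2 × ZMod 2 × ZMod 4) := by
  refine no_dicyclic_law_of_onto_f2cube (A := ZMod 2 × ZMod 2 × ZMod 2 × ZMod 4) (c₀ := (0, 0, 0, 2))
    DihedralLikeGroup.rho_mul_rho DihedralLikeGroup.rho_mul_tau DihedralLikeGroup.tau_mul_rho
    DihedralLikeGroup.tau_mul_tau (by decide) DihedralLikeGroup.rho_injective DihedralLikeGroup.tau_injective
    DihedralLikeGroup.rho_ne_tau DihedralLikeGroup.rho_or_tau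
    (AddMonoidHom.fst _ _) ((AddMonoidHom.fst _ _).comp (AddMonoidHom.snd _ _))
    ((AddMonoidHom.fst _ _).comp ((AddMonoidHom.snd _ _).comp (AddMonoidHom.snd _ _)))
    (by decide) ?_ h
  rintro ⟨v₁, v₂, v₃⟩
  exact ⟨(v₁, v₂, v₃, 0), rfl⟩

/-- **`G(ℤ₂ × ℤ₄ × ℤ₄, (0,2,0)) = C₂ × (ℤ₄ ⋊ Q₈)`** (census row NR119; quotient `ℤ₂² × ℤ₄`): the dicyclic law is not
attained. [folklore] -/
theorem z2_z4_z4_dicyclic_no_law_0_2_0 [Fact (((0, 2, 0) : ZMod 2 × ZMod 4 × ZMod 4) + (0, 2, 0) = 0)]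
    (S T U : Finset (DihedralLikeGroup (ZMod 2 × ZMod 4 × ZMod 4) (0, 2, 0)))
    (h : TripleProductProperty S T U) :
    3 * (S.card * T.card * U.card) + 16 ≠ 8 * Fintype.card (ZMod 2 × ZMod 4 × ZMod 4) := by
  refine no_dicyclic_law_of_onto_f2cube (A := ZMod 2 × ZMod 4 × ZMod 4) (c₀ := (0, 2, 0))
    DihedralLikeGroup.rho_mul_rho DihedralLikeGroup.rho_mul_tau DihedralLikeGroup.tau_mul_rho
    DihedralLikeGroup.tau_mul_tau (by decide) DihedralLikeGroup.rho_injective DihedralLikeGroup.tau_injective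
    DihedralLikeGroup.rho_ne_tau DihedralLikeGroup.rho_or_tau
    (AddMonoidHom.fst _ _)
    ((ZMod.castHom (show 2 ∣ 4 by norm_num) (ZMod 2)).toAddMonoidHom.comp
      ((AddMonoidHom.fst _ _).comp (AddMonoidHom.snd _ _)))
    ((ZMod.castHom (show 2 ∣ 4 by norm_num) (ZMod 2)).toAddMonoidHom.comp
      ((AddMonoidHom.snd _ _).comp (AddMonoidHom.snd _ _)))
    (by decide) ?_ h
  rintro ⟨v₁, v₂, v₃⟩
  obtain ⟨b, hb⟩ := ZMod.castHom_surjective (show 2 ∣ 4 by norm_num) (n := 4) v₂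
  obtain ⟨c, hc⟩ := ZMod.castHom_surjective (show 2 ∣ 4 by norm_num) (n := 4) v₃
  exact ⟨(v₁, b, c), Prod.ext rfl (Prod.ext hb hc)⟩

/-- **`G(ℤ₂ × ℤ₂ × ℤ₂ × ℤ₄, (1,0,0,0)) = C₂² × (ℤ₄ ⋊ ℤ₄)`** (census row NR120; quotient `ℤ₂² × ℤ₄`): the dicyclic law is
not attained. [folklore] -/
theorem z2_z2_z2_z4_dicyclic_no_law_1_0_0_0
    [Fact (((1, 0, 0, 0) : ZMod 2 × ZMod 2 × ZMod 2 × ZMod 4) + (1, 0, 0, 0) = 0)]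
    (S T U : Finset (DihedralLikeGroup (ZMod 2 × ZMod 2 × ZMod 2 × ZMod 4) (1, 0, 0, 0)))
    (h : TripleProductProperty S T U) :
    3 * (S.card * T.card * U.card) + 16 ≠ 8 * Fintype.card (ZMod 2 × ZMod 2 × ZMod 2 × ZMod 4) := by
  refine no_dicyclic_law_of_onto_f2cube (A := ZMod 2 × ZMod 2 × ZMod 2 × ZMod 4) (c₀ := (1, 0, 0, 0))
    DihedralLikeGroup.rho_mul_rho DihedralLikeGroup.rho_mul_tau DihedralLikeGroup.tau_mul_rho
    DihedralLikeGroup.tau_mul_tau (by decide) DihedralLikeGroup.rho_injective DihedralLikeGroup.tau_injective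
    DihedralLikeGroup.rho_ne_tau DihedralLikeGroup.rho_or_tau
    ((AddMonoidHom.fst _ _).comp (AddMonoidHom.snd _ _))
    ((AddMonoidHom.fst _ _).comp ((AddMonoidHom.snd _ _).comp (AddMonoidHom.snd _ _)))
    ((ZMod.castHom (show 2 ∣ 4 by norm_num) (ZMod 2)).toAddMonoidHom.comp
      ((AddMonoidHom.snd _ _).comp ((AddMonoidHom.snd _ _).comp (AddMonoidHom.snd _ _))))
    (by decide) ?_ h
  rintro ⟨v₁, v₂, v₃⟩
  obtain ⟨c, hc⟩ := ZMod.castHom_surjective (show 2 ∣ 4 by norm_num) (n := 4) v₃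
  exact ⟨(0, v₁, v₂, c), Prod.ext rfl (Prod.ext rfl hc)⟩

/-- **`G(ℤ₂⁵, e₁)` (abelian, `≅ ℤ₄ × ℤ₂³`; quotient `ℤ₂⁴`): the dicyclic law is not attained** (trivially consistent with
`β = |G| = 64` for an abelian group; recorded to complete the order-`64` line). [folklore] -/
theorem z2_pow_five_dicyclic_no_law
    [Fact (((1, 0, 0, 0, 0) : ZMod 2 × ZMod 2 × ZMod 2 × ZMod 2 × ZMod 2) + (1, 0, 0, 0, 0) = 0)]
    (S T U : Finset (DihedralLikeGroup (ZMod 2 × ZMod 2 × ZMod 2 × ZMod 2 × ZMod 2) (1, 0, 0, 0, 0)))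
    (h : TripleProductProperty S T U) :
    3 * (S.card * T.card * U.card) + 16 ≠ 8 * Fintype.card (ZMod 2 × ZMod 2 × ZMod 2 × ZMod 2 × ZMod 2) := by
  refine no_dicyclic_law_of_onto_f2cube (A := ZMod 2 × ZMod 2 × ZMod 2 × ZMod 2 × ZMod 2) (c₀ := (1, 0, 0, 0, 0))
    DihedralLikeGroup.rho_mul_rho DihedralLikeGroup.rho_mul_tau DihedralLikeGroup.tau_mul_rho
    DihedralLikeGroup.tau_mul_tau (by decide) DihedralLikeGroup.rho_injective DihedralLikeGroup.tau_injective
    DihedralLikeGroup.rho_ne_tau DihedralLikeGroup.rho_or_tau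
    ((AddMonoidHom.fst _ _).comp (AddMonoidHom.snd _ _))
    ((AddMonoidHom.fst _ _).comp ((AddMonoidHom.snd _ _).comp (AddMonoidHom.snd _ _)))
    ((AddMonoidHom.fst _ _).comp ((AddMonoidHom.snd _ _).comp ((AddMonoidHom.snd _ _).comp (AddMonoidHom.snd _ _))))
    (by decide) ?_ h
  rintro ⟨v₁, v₂, v₃⟩
  exact ⟨(0, v₁, v₂, v₃, 0), rfl⟩

end Instances

end Summit.MatrixMultiplication.OmegaCensus
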